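import Literature.Topology.FourManifolds.SphereProductCohomology
import Literature.Topology.FourManifolds.SphereSurgeryMiddleHomology
import Literature.AlgebraicTopology.SingularHomology.CechCapBridge
import Literature.AlgebraicTopology.SingularHomology.LocalHomologyMayerVietoris
import HarnessLib

/-!
# The local homology at a framed sphere, read through its Poincaré dual

Topic `Literature/Topology/FourManifolds` (fact seat of
`Literature.Topology.FourManifolds.HomotopySphere.mk_eq_mk_iff_sigmaGen_dvd_sub`, Kervaire–Milnor's
Thm. 7.5; the sequel `HomotopySpheresSignatureRepresentation.lean` applies it to Lemma 7.1).
M. Kervaire, J. Milnor, *Groups of homotopy spheres I*, Ann. of Math. 77 (1963), proof of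
**Lemma 7.1**, p. 527: the surgery on an embedded framed sphere `φ(Sᵏ × 0) ⊂ M²ᵏ` is controlled by
intersection numbers with it ("Since `μᵣ·λᵣ = 1` it follows that `Hₖ₋₁M₀ = 0`"), the intersection
pairing being "defined via Poincaré duality and the cup product" on the closed model (footnote
pp. 528–529; Kosinski, *Differential Manifolds* (1993), X §3 p. 204: "If `u, v` are the Poincaré
duals of `x, y ∈ Hₖ(M)`, then `x·y = (u, v)` by [D, VIII, 13.5]"). The surgical engine of the tree
(`SphereSurgeryMiddleHomology.lean`) is phrased through the local homology
`Hₖ(M) → Hₖ(M | ⋃ Sᵢ)` at the spheres; this file identifies that local homology, for ONE framed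
`k`-sphere in any space, with the Kronecker/cup-product data — the homological content of "the Thom
class of the (trivial) normal bundle is Poincaré dual to the sphere" (Milnor–Stasheff, *Characteristic
classes* (1974), §10 and §11, Thm. 11.3, Problem 11-C; Bredon VI.11).

The model is the E₈-seat's `P = Sᵏ × Sᵏ` (`SphereProductCohomology.lean`: `gₐ = prₐ^* γ`,
`yₐ = ιₐ₊[S]`, `⟨gₐ, y_b⟩ = δ`, `|⟨g₁ ⌣ g₂, [P]⟩| = 1`, `Hₖ(P) = ℤy₁ ⊕ ℤy₂`): a framed sphere's tube
`Sᵏ × ℝᵏ` is the tube `Sᵏ × (Sᵏ ∖ n)` of the slice `Z = Sᵏ × {s} = ι₁(Sᵏ)` (stereographic projection).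
Everything is PROVED; no definition and no named fact is introduced (the model tube and the
readings are packaged as `∃`-statements).

* `SphereProd.toLocalOfSet_range_ι₁_surjective`, `…_eq_zero_iff` — `Hₖ(P) → Hₖ(P | Z)` is onto with
  kernel `ℤ·y₁` (`k ≥ 2`; exact sequence of the pair, `P ∖ Z ≃ Sᵏ`).
* `SphereProd.exists_sliceReading` — **`ℓ : Hₖ(P | Z) ≅ ℤ` with `ℓ(z|_Z) = ⟨g₂, z⟩`** (the Thom
  class of the trivial bundle, read homologically).
* `SphereProd.restrictToPoint_range_ι₁_injective` — `H₂ₖ(P | Z) → H₂ₖ(P | z₀)` is injective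
  (Hatcher Thm. 3.26, Lemma 3.27).
* `SphereProd.exists_modelTube` — the open embedding `Sᵏ × ℝᵏ ↪ P` onto the tube of `Z`.
* `SphereProd.SphereTube.eq_smul_map_fst_γ` — `Hᵏ(Sᵏ × ℝᵏ; ℤ) = ℤ·pr₁^*γ`, detected on the zero
  section.
* `SphereProd.SphereTube.exists_reading` — **the main theorem**: for an open embedding
  `E : Sᵏ × ℝᵏ → Y` (`k ≥ 2`, `Y` Hausdorff) with core `C = E(Sᵏ × 0)` there is an isomorphism
  `rd : Hₖ(Y | C; ℤ) ≅ ℤ` such that for every `w ∈ H₂ₖ(Y; ℤ)` restricting to a generator of the local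
  homology at one point of the core (a fundamental class of a closed manifold or closed homology
  manifold containing the tube) there is a sign `ε = ±1` with
  **`rd ((c ⌢ w)|_C) = ε · ⟨c|_{Sᵏ}, [Sᵏ]⟩` for all `c ∈ Hᵏ(Y; ℤ)`**: the local intersection number of
  the Poincaré dual of `c` with the core sphere is the Kronecker value of `c` on it. Proof: relative
  cap product and its projection formula for maps of pairs (`relCapProduct_ofAbsolute`,
  `relativeSingularHomology.map_relCapProduct`), excision to the tube and transport to the model,
  where the local orientation classes of `Y` and of `P` agree up to sign (both restrict to generators
  at a point) and `⟨g₂, g₁ ⌢ [P]⟩ = ⟨g₁ ⌣ g₂, [P]⟩ = ±1`.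

Also: `exists_linearMap_comp_eq_of_ker_le` (descent of a linear map along a surjection),
`eq_or_eq_neg_of_generators` (generators of infinite cyclic groups),
`isIso_relMap_of_isOpenEmbedding_of_eq`, `restrictToPoint_map_comm` (bookkeeping for maps of pairs).

## References

* M. Kervaire, J. Milnor, *Groups of homotopy spheres I*, Ann. of Math. 77 (1963), Lemma 7.1
  (proof, p. 527 l. 1–9), §7 p. 528 and footnote pp. 528–529. doi:10.2307/1970128
  [KervaireMilnorAnnals1963]
* J. Milnor, J. Stasheff, *Characteristic classes* (1974), §10 (Thom isomorphism), §11
  (Thm. 11.3, Problem 11-C: the dual class of a submanifold). [MilnorStasheff1974]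
* A. Kosinski, *Differential Manifolds* (1993), Ch. X §3, p. 204. [Kosinski1993]
* A. Hatcher, *Algebraic Topology* (2002), Example 3.11, §3.3 pp. 239–241 (cap product, relative
  version and projection formula), Thm. 3.26, Lemma 3.27, Thm. 2.20, Cor. 2.11, Thm. 3.2.
  [HatcherAT2002]
-/

noncomputable section

open scoped Manifold Topology
open Set Function CategoryTheory CategoryTheory.Limits Topology
open Literature.AlgebraicTopology.SingularHomology

namespace Literature.Topology.FourManifolds

/-- **Descent of a linear map along a surjection**: if `ρ : M → N` is onto and `ker ρ ≤ ker κ`,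
then `κ = ℓ ∘ ρ` for a (unique) linear `ℓ : N → P`. [folklore] -/
theorem exists_linearMap_comp_eq_of_ker_le {R : Type*} [CommRing R] {M N P : Type*}
    [AddCommGroup M] [Module R M] [AddCommGroup N] [Module R N] [AddCommGroup P] [Module R P]
    (ρ : M →ₗ[R] N) (κ : M →ₗ[R] P) (hsurj : Surjective ρ)
    (hker : LinearMap.ker ρ ≤ LinearMap.ker κ) : ∃ ℓ : N →ₗ[R] P, ∀ m, ℓ (ρ m) = κ m := by
  refine ⟨(LinearMap.ker ρ).liftQ κ hker ∘ₗ (ρ.quotKerEquivOfSurjective hsurj).symm.toLinearMap,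
    fun m => ?_⟩
  have h1 : ρ.quotKerEquivOfSurjective hsurj (Submodule.Quotient.mk m) = ρ m := rfl
  rw [LinearMap.comp_apply, LinearEquiv.coe_toLinearMap, ← h1, LinearEquiv.symm_apply_apply,
    Submodule.liftQ_apply]

namespace SphereProd

variable {k : ℕ}

/-! ### The core slice `Z = ι₁(Sᵏ) = Sᵏ × {s}` of `P = Sᵏ × Sᵏ` and its complement -/

/-- Membership in the core slice `Z = ι₁(Sᵏ) = Sᵏ × {s}`. [folklore] -/
theorem mem_range_ι₁_iff (q : (Metric.sphere (0 : EuclideanSpace ℝ (Fin (k + 1))) 1) ×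
    (Metric.sphere (0 : EuclideanSpace ℝ (Fin (k + 1))) 1)) :
    q ∈ range (ι₁ k) ↔ q.2 = southPole k := by
  constructor
  · rintro ⟨x, rfl⟩; rfl
  · intro hq
    exact ⟨q.1, Prod.ext rfl hq.symm⟩

/-- `Z` is closed. [folklore] -/
theorem isClosed_range_ι₁ : IsClosed (range (ι₁ k)) := by
  have : range (ι₁ k) = {q | q.2 = southPole k} := Set.ext mem_range_ι₁_iff
  rw [this]
  exact isClosed_eq continuous_snd continuous_const

/-- `(x, n) ∉ Z`. [folklore] -/
theorem mk_northPole_not_mem_range_ι₁ (x : Metric.sphere (0 : EuclideanSpace ℝ (Fin (k + 1))) 1) :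
    (x, northPole k) ∉ range (ι₁ k) := fun h =>
  southPole_ne_northPole ((mem_range_ι₁_iff _).1 h).symm

/-- **`x ↦ (x, n) : Sᵏ → P ∖ Z` induces isomorphisms on homology** (`P ∖ Z = Sᵏ × (Sᵏ ∖ s)`
deformation retracts onto the slice; Hatcher Cor. 2.11). [cite: HatcherAT2002, Cor. 2.11] -/
theorem isIso_map_complSliceMap (j : ℕ) :
    IsIso (singularHomology.map ℤ ℤ
      (⟨fun x => ⟨(x, northPole k), mk_northPole_not_mem_range_ι₁ x⟩, by fun_prop⟩ :
        C((Metric.sphere (0 : EuclideanSpace ℝ (Fin (k + 1))) 1), ↥((range (ι₁ k))ᶜ))) j) := by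
  haveI := contractibleSpace_compl_singleton (k := k) (southPole k)
  -- `P ∖ Z ≅ (Sᵏ ∖ s) × Sᵏ` (swap), under which `x ↦ (x, n)` is the slice `x ↦ (n, x)`
  let e : ↥((range (ι₁ k))ᶜ) ≃ₜ
      ↥(({southPole k}ᶜ : Set (Metric.sphere (0 : EuclideanSpace ℝ (Fin (k + 1))) 1))) ×
        (Metric.sphere (0 : EuclideanSpace ℝ (Fin (k + 1))) 1) :=
    { toFun := fun q => (⟨q.1.2, fun h => q.2 ((mem_range_ι₁_iff _).2 (mem_singleton_iff.1 h))⟩, q.1.1)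
      invFun := fun p => ⟨(p.2, p.1.1), fun h => p.1.2 ((mem_range_ι₁_iff _).1 h)⟩
      left_inv := fun q => rfl
      right_inv := fun p => rfl
      continuous_toFun := by fun_prop
      continuous_invFun := by fun_prop }
  let n' : ↥(({southPole k}ᶜ : Set (Metric.sphere (0 : EuclideanSpace ℝ (Fin (k + 1))) 1))) :=
    ⟨northPole k, fun h => southPole_ne_northPole (mem_singleton_iff.1 h).symm⟩
  have hfac : (e : C(↥((range (ι₁ k))ᶜ), ↥(({southPole k}ᶜ : Set (Metric.sphere (0 : EuclideanSpace ℝ (Fin (k + 1))) 1))) ×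
        (Metric.sphere (0 : EuclideanSpace ℝ (Fin (k + 1))) 1))).comp
      (⟨fun x => ⟨(x, northPole k), mk_northPole_not_mem_range_ι₁ x⟩, by fun_prop⟩ :
        C((Metric.sphere (0 : EuclideanSpace ℝ (Fin (k + 1))) 1), ↥((range (ι₁ k))ᶜ))) =
      sliceMap (Y := (Metric.sphere (0 : EuclideanSpace ℝ (Fin (k + 1))) 1)) n' :=
    ContinuousMap.ext fun _ => rfl
  have h1 := isIso_map_sliceMap (Y := (Metric.sphere (0 : EuclideanSpace ℝ (Fin (k + 1))) 1)) n' j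
  rw [← hfac, singularHomology.map_comp] at h1
  haveI : IsIso (singularHomology.map ℤ ℤ
      (e : C(↥((range (ι₁ k))ᶜ), ↥(({southPole k}ᶜ : Set (Metric.sphere (0 : EuclideanSpace ℝ (Fin (k + 1))) 1))) ×
        (Metric.sphere (0 : EuclideanSpace ℝ (Fin (k + 1))) 1))) j) :=
    (singularHomology.mapIso ℤ ℤ e j).isIso_hom
  exact IsIso.of_isIso_comp_right _ (singularHomology.map ℤ ℤ
      (e : C(↥((range (ι₁ k))ᶜ), ↥(({southPole k}ᶜ : Set (Metric.sphere (0 : EuclideanSpace ℝ (Fin (k + 1))) 1))) ×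
        (Metric.sphere (0 : EuclideanSpace ℝ (Fin (k + 1))) 1))) j)

/-- `Hⱼ(P ∖ Z; ℤ) = 0` for `j ≠ 0, k`. [cite: HatcherAT2002, Cor. 2.11 and Cor. 2.14] -/
theorem isZero_singularHomology_complSlice {j : ℕ} (hj : j ≠ 0) (hjk : j ≠ k) :
    IsZero (singularHomology ℤ ℤ ↥((range (ι₁ k))ᶜ) j) := by
  exact (isZero_singularHomology_sphere hj hjk).of_iso
    (@asIso _ _ _ _ _ (isIso_map_complSliceMap (k := k) j)).symm

/-- `x ↦ (x, n)` followed by the inclusion `P ∖ Z ⊂ P` is homotopic to `ι₁ : x ↦ (x, s)` (move the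
second coordinate along a path from `n` to `s`; `k ≥ 2`). [folklore] -/
theorem homotopic_subsetIncl_comp_complSliceMap (hk : 2 ≤ k) :
    ((subsetIncl ((range (ι₁ k))ᶜ)).comp
      (⟨fun x => ⟨(x, northPole k), mk_northPole_not_mem_range_ι₁ x⟩, by fun_prop⟩ :
        C((Metric.sphere (0 : EuclideanSpace ℝ (Fin (k + 1))) 1), ↥((range (ι₁ k))ᶜ)))).Homotopic (ι₁ k) := by
  haveI := simplyConnectedSpace_sphere hk
  have H : (ContinuousMap.const (Metric.sphere (0 : EuclideanSpace ℝ (Fin (k + 1))) 1) (northPole k)).Homotopic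
      (ContinuousMap.const _ (southPole k)) := ⟨homotopyConst _ _⟩
  obtain ⟨F⟩ := H
  have e0 : (subsetIncl ((range (ι₁ k))ᶜ)).comp
      (⟨fun x => ⟨(x, northPole k), mk_northPole_not_mem_range_ι₁ x⟩, by fun_prop⟩ :
        C((Metric.sphere (0 : EuclideanSpace ℝ (Fin (k + 1))) 1), ↥((range (ι₁ k))ᶜ))) =
      (ContinuousMap.id _).prodMk (ContinuousMap.const _ (northPole k)) := by ext x <;> rfl
  have e1 : ι₁ k = (ContinuousMap.id _).prodMk (ContinuousMap.const _ (southPole k)) := by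
    ext x <;> rfl
  rw [e0, e1]
  exact ⟨(ContinuousMap.Homotopy.refl _).prod F⟩

/-! ### Local homology of `P` along `Z` in the middle degree: `Hₖ(P | Z) ≅ ℤ`, read by `g₂` -/

/-- **`Hₖ(P) → Hₖ(P | Z)` is onto** (`k ≥ 2`): the next term `Hₖ₋₁(P ∖ Z) ≅ Hₖ₋₁(Sᵏ)` of the exact
sequence of the pair vanishes. [cite: HatcherAT2002, §2.1 (exact sequence of the pair) and Cor. 2.14] -/
theorem toLocalOfSet_range_ι₁_surjective (hk : 2 ≤ k) :
    Surjective (singularHomology.toLocalOfSet ℤ ℤ _ (range (ι₁ k)) k) := by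
  obtain ⟨m, rfl⟩ : ∃ m, k = m + 1 := ⟨k - 1, by omega⟩
  have hex := relativeSingularHomology.exact_ofAbsolute_δ ℤ ℤ ((range (ι₁ (m + 1)))ᶜ) m
  haveI := ModuleCat.subsingleton_of_isZero
    (isZero_singularHomology_complSlice (k := m + 1) (j := m) (by omega) (by omega))
  intro z
  obtain ⟨w, hw⟩ := (ShortComplex.moduleCat_exact_iff _).1 hex z (Subsingleton.elim _ _)
  exact ⟨w, hw⟩

/-- **The kernel of `Hₖ(P) → Hₖ(P | Z)` is `ℤ·y₁`** (`y₁ = ι₁₊[S] = [Z]`, the class of the core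
itself; `k ≥ 2`): it is the image of `Hₖ(P ∖ Z) = ℤ·[Sᵏ × n]`, and `Sᵏ × n` is homotopic to
`Sᵏ × s`. [cite: HatcherAT2002, §2.1 (exact sequence of the pair), Example 3.11] -/
theorem toLocalOfSet_range_ι₁_eq_zero_iff (hk : 2 ≤ k)
    (z : singularHomology ℤ ℤ ((Metric.sphere (0 : EuclideanSpace ℝ (Fin (k + 1))) 1) ×
      (Metric.sphere (0 : EuclideanSpace ℝ (Fin (k + 1))) 1)) k) :
    singularHomology.toLocalOfSet ℤ ℤ _ (range (ι₁ k)) k z = 0 ↔ ∃ c : ℤ, z = c • y hk 0 := by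
  set f : C((Metric.sphere (0 : EuclideanSpace ℝ (Fin (k + 1))) 1), ↥((range (ι₁ k))ᶜ)) :=
    ⟨fun x => ⟨(x, northPole k), mk_northPole_not_mem_range_ι₁ x⟩, by fun_prop⟩ with hf
  have hhom : singularHomology.map ℤ ℤ (subsetIncl ((range (ι₁ k))ᶜ)) k ≫ 
      singularHomology.toLocalOfSet ℤ ℤ _ (range (ι₁ k)) k = 0 :=
    relativeSingularHomology.map_comp_ofAbsolute ℤ ℤ ((range (ι₁ k))ᶜ) k
  have hy : y hk 0 = singularHomology.map ℤ ℤ (subsetIncl ((range (ι₁ k))ᶜ)) k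
      (singularHomology.map ℤ ℤ f k (μS hk).fundamentalClass) := by
    rw [← ModuleCat.comp_apply, ← singularHomology.map_comp,
      singularHomology.map_eq_of_homotopic ℤ ℤ (homotopic_subsetIncl_comp_complSliceMap hk) k]
    rfl
  constructor
  · intro hz
    have hex := relativeSingularHomology.exact_map_ofAbsolute ℤ ℤ ((range (ι₁ k))ᶜ) k
    obtain ⟨w, rfl⟩ := (ShortComplex.moduleCat_exact_iff _).1 hex z hz
    obtain ⟨w', rfl⟩ := ((ConcreteCategory.isIso_iff_bijective _).1
      (isIso_map_complSliceMap (k := k) k)).2 w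
    obtain ⟨c, rfl⟩ := exists_eq_smul_fundamentalClass_sphere hk w'
    refine ⟨c, ?_⟩
    rw [hy, map_zsmul, map_zsmul]
  · rintro ⟨c, rfl⟩
    have h0 : (singularHomology.map ℤ ℤ (subsetIncl ((range (ι₁ k))ᶜ)) k ≫
        singularHomology.toLocalOfSet ℤ ℤ _ (range (ι₁ k)) k)
        (singularHomology.map ℤ ℤ f k (μS hk).fundamentalClass) = 0 := by
      rw [hhom]; rfl
    rw [map_zsmul, hy, ← ModuleCat.comp_apply, h0]
    exact zsmul_zero c

/-- **The reading `ℓ : Hₖ(P | Z) ≅ ℤ` of the local homology along the core slice**: there is a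
unique homomorphism `ℓ` with `ℓ(z|_Z) = ⟨g₂, z⟩` for all `z ∈ Hₖ(P)` (`g₂ = pr₂^* γ` kills the kernel
`ℤ·y₁`), and it is bijective (`Hₖ(P | Z)` is generated by `y₂|_Z`, `⟨g₂, y₂⟩ = 1`). This is the Thom
class of the trivial normal bundle of `Z`, read homologically. [cite: HatcherAT2002, Example 3.11; MilnorStasheff1974, §10 (Thom class of a trivial bundle)] -/
theorem exists_sliceReading (hk : 2 ≤ k) :
    ∃ ℓ : localHomologyOfSet ℤ ℤ ((Metric.sphere (0 : EuclideanSpace ℝ (Fin (k + 1))) 1) ×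
        (Metric.sphere (0 : EuclideanSpace ℝ (Fin (k + 1))) 1)) (range (ι₁ k)) k →ₗ[ℤ] ℤ,
      Bijective ℓ ∧ ∀ z, ℓ (singularHomology.toLocalOfSet ℤ ℤ
        ((Metric.sphere (0 : EuclideanSpace ℝ (Fin (k + 1))) 1) ×
          (Metric.sphere (0 : EuclideanSpace ℝ (Fin (k + 1))) 1)) (range (ι₁ k)) k z) =
        kroneckerPairing ℤ ℤ ((Metric.sphere (0 : EuclideanSpace ℝ (Fin (k + 1))) 1) ×
          (Metric.sphere (0 : EuclideanSpace ℝ (Fin (k + 1))) 1)) k (g hk 1) z := by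
  set ρ := (singularHomology.toLocalOfSet ℤ ℤ ((Metric.sphere (0 : EuclideanSpace ℝ (Fin (k + 1))) 1) ×
        (Metric.sphere (0 : EuclideanSpace ℝ (Fin (k + 1))) 1)) (range (ι₁ k)) k).hom with hρ
  set κ := kroneckerPairing ℤ ℤ ((Metric.sphere (0 : EuclideanSpace ℝ (Fin (k + 1))) 1) ×
        (Metric.sphere (0 : EuclideanSpace ℝ (Fin (k + 1))) 1)) k (g hk 1) with hκ
  have hsurj : Surjective ρ := toLocalOfSet_range_ι₁_surjective hk
  have hker : LinearMap.ker ρ ≤ LinearMap.ker κ := by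
    intro z hz
    rw [LinearMap.mem_ker] at hz ⊢
    obtain ⟨c, rfl⟩ := (toLocalOfSet_range_ι₁_eq_zero_iff hk z).1 hz
    rw [map_zsmul, hκ, kroneckerPairing_g_y_of_ne hk (by decide), smul_zero]
  obtain ⟨ℓ, hℓ⟩ := exists_linearMap_comp_eq_of_ker_le ρ κ hsurj hker
  refine ⟨ℓ, ⟨?_, ?_⟩, hℓ⟩
  · -- injective: `Hₖ(P | Z) = ℤ · ρ(y₂)` and `ℓ (ρ y₂) = 1`
    rw [injective_iff_map_eq_zero]
    intro x hx
    obtain ⟨z, rfl⟩ := hsurj x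
    obtain ⟨c, rfl⟩ := exists_eq_sum_smul_y hk z
    have hc1 : c 1 = 0 := by
      rw [hℓ, map_add, map_zsmul, map_zsmul, hκ, kroneckerPairing_g_y_of_ne hk (by decide),
        kroneckerPairing_g_y_self] at hx
      simpa using hx
    rw [hc1, zero_smul, add_zero]
    exact (toLocalOfSet_range_ι₁_eq_zero_iff hk _).2 ⟨c 0, rfl⟩
  · intro m
    refine ⟨ρ (m • y hk 1), ?_⟩
    rw [hℓ, map_zsmul, hκ, kroneckerPairing_g_y_self, smul_eq_mul, mul_one]

/-! ### Local homology of `P` along `Z` in the top degree is detected at a point -/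

/-- **Restriction `H₂ₖ(P | Z) → H₂ₖ(P | z₀)` to a point of the core slice is injective** (`k ≥ 2`):
`H₂ₖ(P) → H₂ₖ(P | Z)` is onto (`H₂ₖ₋₁(P ∖ Z) = H₂ₖ₋₁(Sᵏ) = 0`) and `H₂ₖ(P) → H₂ₖ(P | z₀)` is an
isomorphism for the closed connected orientable `2k`-manifold `P` (Hatcher Thm. 3.26(a)).
[cite: HatcherAT2002, Thm. 3.26(a), Lemma 3.27] -/
theorem restrictToPoint_range_ι₁_injective (hk : 2 ≤ k)
    {z₀ : (Metric.sphere (0 : EuclideanSpace ℝ (Fin (k + 1))) 1) ×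
      (Metric.sphere (0 : EuclideanSpace ℝ (Fin (k + 1))) 1)} (hz₀ : z₀ ∈ range (ι₁ k)) :
    Injective (restrictToPoint ℤ ℤ hz₀ (k + k)) := by
  letI := chartedSpace k
  haveI := SphereProd.simplyConnectedSpace (k := k) hk
  obtain ⟨μ⟩ := isOrientableOver hk
  -- `H₂ₖ(P) → H₂ₖ(P | Z)` is onto
  obtain ⟨m, hm⟩ : ∃ m, k + k = m + 1 := ⟨k + k - 1, by omega⟩
  have hsurj : Surjective (singularHomology.toLocalOfSet ℤ ℤ _ (range (ι₁ k)) (k + k)) := by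
    rw [hm]
    have hex := relativeSingularHomology.exact_ofAbsolute_δ ℤ ℤ ((range (ι₁ k))ᶜ) m
    haveI := ModuleCat.subsingleton_of_isZero
      (isZero_singularHomology_complSlice (k := k) (j := m) (by omega) (by omega))
    intro z
    obtain ⟨w, hw⟩ := (ShortComplex.moduleCat_exact_iff _).1 hex z (Subsingleton.elim _ _)
    exact ⟨w, hw⟩
  haveI := singularHomology.isIso_toLocal_of_orientation μ z₀
  intro a b hab
  obtain ⟨a, rfl⟩ := hsurj a
  obtain ⟨b, rfl⟩ := hsurj b
  rw [singularHomology.restrictToPoint_toLocalOfSet, singularHomology.restrictToPoint_toLocalOfSet] at hab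
  rw [((ConcreteCategory.isIso_iff_bijective _).1
    (singularHomology.isIso_toLocal_of_orientation μ z₀)).1 hab]


/-! ### The model tube `Sᵏ × ℝᵏ ↪ P` around the core slice -/

/-- **The model tube**: an open embedding `j : Sᵏ × ℝᵏ → Sᵏ × Sᵏ` over the first factor whose
zero section is `ι₁` and which meets the core slice `Z = ι₁(Sᵏ)` exactly in the zero section
(stereographic projection of the second factor from the north pole, recentred at the south pole).
[cite: HatcherAT2002, §0 p. 6 (Sⁿ minus a point ≅ ℝⁿ)] -/
theorem exists_modelTube (k : ℕ) :
    ∃ j : (Metric.sphere (0 : EuclideanSpace ℝ (Fin (k + 1))) 1) × EuclideanSpace ℝ (Fin k) →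
        (Metric.sphere (0 : EuclideanSpace ℝ (Fin (k + 1))) 1) ×
          (Metric.sphere (0 : EuclideanSpace ℝ (Fin (k + 1))) 1),
      IsOpenEmbedding j ∧ (∀ x, j (x, 0) = ι₁ k x) ∧ (∀ p, (j p).1 = p.1) ∧
        ∀ p, j p ∈ range (ι₁ k) → p.2 = 0 := by
  haveI : Fact (Module.finrank ℝ (EuclideanSpace ℝ (Fin (k + 1))) = k + 1) :=
    ⟨finrank_euclideanSpace_fin⟩
  let e := stereographic' (E := EuclideanSpace ℝ (Fin (k + 1))) k (northPole k)
  have hs : e.source = ({northPole k}ᶜ : Set (Metric.sphere (0 : EuclideanSpace ℝ (Fin (k + 1))) 1)) :=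
    stereographic'_source (northPole k)
  have ht : e.target = Set.univ := stereographic'_target (northPole k)
  let φ : ↥(({northPole k}ᶜ : Set (Metric.sphere (0 : EuclideanSpace ℝ (Fin (k + 1))) 1))) ≃ₜ
      EuclideanSpace ℝ (Fin k) :=
    ((Homeomorph.setCongr hs).symm.trans e.toHomeomorphSourceTarget).trans
      ((Homeomorph.setCongr ht).trans (Homeomorph.Set.univ (EuclideanSpace ℝ (Fin k))))
  let s₀ : ↥(({northPole k}ᶜ : Set (Metric.sphere (0 : EuclideanSpace ℝ (Fin (k + 1))) 1))) :=
    ⟨southPole k, fun h => southPole_ne_northPole (mem_singleton_iff.1 h)⟩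
  let ψ : EuclideanSpace ℝ (Fin k) ≃ₜ
      ↥(({northPole k}ᶜ : Set (Metric.sphere (0 : EuclideanSpace ℝ (Fin (k + 1))) 1))) :=
    (Homeomorph.addRight (φ s₀)).trans φ.symm
  have hψ0 : ψ 0 = s₀ := by
    change φ.symm (0 + φ s₀) = s₀
    rw [zero_add, Homeomorph.symm_apply_apply]
  refine ⟨fun p => (p.1, (ψ p.2).1), ?_, fun x => ?_, fun p => rfl, fun p hp => ?_⟩
  · have h1 : IsOpenEmbedding (Prod.map (id : (Metric.sphere (0 : EuclideanSpace ℝ (Fin (k + 1))) 1) → _)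
        (Subtype.val : ↥(({northPole k}ᶜ : Set (Metric.sphere (0 : EuclideanSpace ℝ (Fin (k + 1))) 1))) → _)) :=
      IsOpenEmbedding.id.prodMap isOpen_compl_singleton.isOpenEmbedding_subtypeVal
    have h2 : IsOpenEmbedding (Prod.map (id : (Metric.sphere (0 : EuclideanSpace ℝ (Fin (k + 1))) 1) → _) ψ) :=
      ((Homeomorph.refl _).prodCongr ψ).isOpenEmbedding
    exact h1.comp h2
  · change (x, (ψ 0).1) = (x, southPole k)
    rw [hψ0]
  · have h2 : (ψ p.2).1 = southPole k := (mem_range_ι₁_iff _).1 hp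
    have h3 : ψ p.2 = ψ 0 := by rw [hψ0]; exact Subtype.ext h2
    exact ψ.injective h3

/-! ### Generators of infinite cyclic groups -/

/-- Two generators of an infinite cyclic group agree up to sign. [folklore] -/
theorem eq_or_eq_neg_of_generators {L : Type*} [AddCommGroup L] [Module ℤ L] {a b : L}
    (ha : ∃ e : L ≃ₗ[ℤ] ℤ, e a = 1) (hb : ∃ e : L ≃ₗ[ℤ] ℤ, e b = 1) :
    ∃ ε : ℤ, (ε = 1 ∨ ε = -1) ∧ a = ε • b := by
  obtain ⟨e, he⟩ := ha
  obtain ⟨f, hf⟩ := hb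
  have hab : a = (f a) • b := f.injective (by simp [hf])
  have h2 : e a = f a * e b := by
    conv_lhs => rw [hab]
    simp
  have hunit : f a * e b = 1 := by rw [← h2, he]
  refine ⟨f a, ?_, hab⟩
  rcases Int.eq_one_or_neg_one_of_mul_eq_one hunit with h | h
  · exact Or.inl h
  · exact Or.inr h

/-! ### Cohomology of the tube `Sᵏ × ℝᵏ` in degree `k` -/

/-- **`Hᵏ(Sᵏ × ℝᵏ; ℤ) = ℤ · pr₁^* γ`, detected on the zero section**: every class `c` equals
`⟨s^* c, [Sᵏ]⟩ · pr₁^* γ` for the zero section `s(x) = (x, 0)` (the tube deformation retracts onto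
its zero section; `Hᵏ(Sᵏ; ℤ) = ℤγ` by universal coefficients). [cite: HatcherAT2002, §3.1 p. 201 and Thm. 3.2] -/
theorem SphereTube.eq_smul_map_fst_γ (hk : 2 ≤ k)
    (c : singularCohomology ℤ ℤ ((Metric.sphere (0 : EuclideanSpace ℝ (Fin (k + 1))) 1) ×
      EuclideanSpace ℝ (Fin k)) k) :
    c = kroneckerPairing ℤ ℤ (Metric.sphere (0 : EuclideanSpace ℝ (Fin (k + 1))) 1) k
        (singularCohomology.map ℤ ℤ (⟨fun x => (x, 0), by fun_prop⟩ : C((Metric.sphere (0 : EuclideanSpace ℝ (Fin (k + 1))) 1),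
          (Metric.sphere (0 : EuclideanSpace ℝ (Fin (k + 1))) 1) × EuclideanSpace ℝ (Fin k))) k c)
          (μS hk).fundamentalClass •
      singularCohomology.map ℤ ℤ (⟨Prod.fst, continuous_fst⟩ : C((Metric.sphere (0 : EuclideanSpace ℝ (Fin (k + 1))) 1) ×
          EuclideanSpace ℝ (Fin k), (Metric.sphere (0 : EuclideanSpace ℝ (Fin (k + 1))) 1))) k (γ hk) := by
  set zs : C((Metric.sphere (0 : EuclideanSpace ℝ (Fin (k + 1))) 1),
      (Metric.sphere (0 : EuclideanSpace ℝ (Fin (k + 1))) 1) × EuclideanSpace ℝ (Fin k)) :=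
    ⟨fun x => (x, 0), by fun_prop⟩ with hzs
  set pr : C((Metric.sphere (0 : EuclideanSpace ℝ (Fin (k + 1))) 1) × EuclideanSpace ℝ (Fin k),
      (Metric.sphere (0 : EuclideanSpace ℝ (Fin (k + 1))) 1)) := ⟨Prod.fst, continuous_fst⟩ with hpr
  -- `zs ∘ pr ≃ id`
  have hhtp : (zs.comp pr).Homotopic (ContinuousMap.id _) := by
    have H : (ContinuousMap.const (EuclideanSpace ℝ (Fin k)) (0 : EuclideanSpace ℝ (Fin k))).Homotopic
        (ContinuousMap.id _) := by
      obtain ⟨v, ⟨Hv⟩⟩ := id_nullhomotopic (EuclideanSpace ℝ (Fin k))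
      exact ⟨(homotopyConst (0 : EuclideanSpace ℝ (Fin k)) v).trans Hv.symm⟩
    have e0 : zs.comp pr = (ContinuousMap.id _).prodMap (ContinuousMap.const (EuclideanSpace ℝ (Fin k)) (0 : EuclideanSpace ℝ (Fin k))) := by
      ext p <;> rfl
    have e1 : ContinuousMap.id ((Metric.sphere (0 : EuclideanSpace ℝ (Fin (k + 1))) 1) × EuclideanSpace ℝ (Fin k)) =
        (ContinuousMap.id _).prodMap (ContinuousMap.id _) := by
      ext p <;> rfl
    rw [e0, e1]
    exact (ContinuousMap.Homotopic.refl _).prodMap H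
  -- `zs^* c = t • γ` on `Sᵏ`
  set t : ℤ := kroneckerPairing ℤ ℤ _ k (singularCohomology.map ℤ ℤ zs k c) (μS hk).fundamentalClass with ht
  have hzsc : singularCohomology.map ℤ ℤ zs k c = t • γ hk := by
    have hinj : Injective (kroneckerPairing ℤ ℤ (Metric.sphere (0 : EuclideanSpace ℝ (Fin (k + 1))) 1) k) := by
      obtain ⟨m, rfl⟩ : ∃ m, k = m + 1 := ⟨k - 1, by omega⟩
      exact (kroneckerPairing_bijective_of_isZero ℤ (Metric.sphere (0 : EuclideanSpace ℝ (Fin (m + 1 + 1))) 1) m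
        (isZero_singularHomology_sphere (k := m + 1) (j := m) (by omega) (by omega))).1
    apply hinj
    ext z
    obtain ⟨d, rfl⟩ := exists_eq_smul_fundamentalClass_sphere hk z
    rw [ht]
    simp only [map_zsmul, LinearMap.smul_apply, kroneckerPairing_γ, smul_eq_mul, mul_one]
  calc c = singularCohomology.map ℤ ℤ (ContinuousMap.id _) k c := by rw [singularCohomology.map_id]; rfl
    _ = singularCohomology.map ℤ ℤ (zs.comp pr) k c := by
        rw [singularCohomology.map_eq_of_homotopic_holds ℤ ℤ hhtp k]
    _ = singularCohomology.map ℤ ℤ pr k (singularCohomology.map ℤ ℤ zs k c) := by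
        rw [singularCohomology.map_comp, ModuleCat.comp_apply]
    _ = t • singularCohomology.map ℤ ℤ pr k (γ hk) := by rw [hzsc, map_zsmul]


/-! ### The reading of the local homology along the core of an embedded tube -/

/-! ### Two bookkeeping lemmas for maps of pairs -/

/-- Excision along an open embedding, with the image set rewritten. [cite: HatcherAT2002, Thm. 2.20] -/
theorem isIso_relMap_of_isOpenEmbedding_of_eq {O Y' : Type} [TopologicalSpace O] [TopologicalSpace Y']
    {κ : O → Y'} (hκ : IsOpenEmbedding κ) {K : Set O} {B : Set Y'} (hB : κ '' K = B) (hK : IsClosed B)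
    (h : MapsTo κ Kᶜ Bᶜ) (q : ℕ) : IsIso (relativeSingularHomology.map ℤ ℤ ⟨κ, hκ.continuous⟩ h q) := by
  subst hB
  exact isIso_relMap_of_isOpenEmbedding ℤ ℤ hκ hK h q

/-- Restriction to a point commutes with maps of pairs. [cite: HatcherAT2002, §3.3 p. 233 (naturality)] -/
theorem restrictToPoint_map_comm {O Y' : Type} [TopologicalSpace O] [TopologicalSpace Y']
    (f : C(O, Y')) {K : Set O} {L : Set Y'} (h₁ : MapsTo f Kᶜ Lᶜ) {x : O} (hx : x ∈ K)
    (hfx : f x ∈ L) (h₂ : MapsTo f ({x} : Set O)ᶜ ({f x} : Set Y')ᶜ) (q : ℕ)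
    (z : localHomologyOfSet ℤ ℤ O K q) :
    restrictToPoint ℤ ℤ hfx q (relativeSingularHomology.map ℤ ℤ f h₁ q z) =
      relativeSingularHomology.map ℤ ℤ f h₂ q (restrictToPoint ℤ ℤ hx q z) := by
  have hfg : (ContinuousMap.id _).comp f = f.comp (ContinuousMap.id _) := by ext; rfl
  change (relativeSingularHomology.map ℤ ℤ f h₁ q ≫ restrictToPoint ℤ ℤ hfx q) z =
    (restrictToPoint ℤ ℤ hx q ≫ relativeSingularHomology.map ℤ ℤ f h₂ q) z
  congr 1
  dsimp only [restrictToPoint, restrictLocal]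
  rw [← relativeSingularHomology.map_comp, ← relativeSingularHomology.map_comp]
  congr 1

section Tube

/-- An injective tube maps the complement of the zero section into the complement of the core.
[folklore] -/
theorem SphereTube.mapsTo_compl_core {Y : Type*}
    {E : (Metric.sphere (0 : EuclideanSpace ℝ (Fin (k + 1))) 1) × EuclideanSpace ℝ (Fin k) → Y}
    (hE : Injective E) :
    MapsTo E (univ ×ˢ ({0} : Set (EuclideanSpace ℝ (Fin k))))ᶜ
      (E '' (univ ×ˢ ({0} : Set (EuclideanSpace ℝ (Fin k)))))ᶜ := by
  intro p hp hmem
  obtain ⟨p', hp', he⟩ := hmem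
  rw [hE he] at hp'
  exact hp hp'

/-- **The reading of `Hₖ(Y | core)` along an embedded framed sphere, and the Poincaré-dual
formula.** Let `E : Sᵏ × ℝᵏ → Y` be an open embedding (`k ≥ 2`, `Y` Hausdorff) with core
`C = E(Sᵏ × 0)`. Then there is an isomorphism `rd : Hₖ(Y | C; ℤ) ≅ ℤ` — excision to the tube,
transport to the model tube around `Z = Sᵏ × s ⊂ P = Sᵏ × Sᵏ`, and the reading `⟨g₂, -⟩` there
(the Thom class of the trivial normal bundle) — such that **for every class `ω ∈ H₂ₖ(Y; ℤ)`
restricting to a generator of the local homology at one point of the core** (e.g. the fundamental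
class of a closed oriented `2k`-manifold, or of a closed homology manifold, containing the tube)
there is a sign `ε = ±1` with

  `rd ((c ⌢ ω)|_C) = ε · ⟨c|_{Sᵏ}, [Sᵏ]⟩` for all `c ∈ Hᵏ(Y; ℤ)`,

`c|_{Sᵏ}` the restriction along the core sphere `x ↦ E (x, 0)`: the intersection number of the
Poincaré dual of `c` with the core sphere is the Kronecker value of `c` on it (Milnor–Stasheff
Problem 11-C / Thm. 11.3 for the trivial normal bundle; Bredon VI.11.9; Dold VIII.13.5, as used by
Kosinski X §3 p. 204 and Kervaire–Milnor p. 528, footnote). Proof: `(c ⌢ ω)|_C = c ⌢ ω|_C`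
(relative cap product) is computed in the tube by naturality (projection formula for maps of
pairs); there `c = t · pr₁^*γ` with `t = ⟨c|_{Sᵏ}, [Sᵏ]⟩`, and `ω|_C` agrees up to sign with the
local class of `[P]`, both restricting to generators at a point (Hatcher Lemma 3.27); in `P`,
`⟨g₂, g₁ ⌢ [P]⟩ = ⟨g₁ ⌣ g₂, [P]⟩ = ±1`. [cite: MilnorStasheff1974, §11, Problem 11-C and Thm. 11.3] [cite: HatcherAT2002, §3.3 p. 241 (relative projection formula), Lemma 3.27, Example 3.11] [cite: KervaireMilnorAnnals1963, §7 p. 527 l. 7–9 and footnote pp. 528–529] -/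
theorem SphereTube.exists_reading (hk : 2 ≤ k) {Y : Type} [TopologicalSpace Y] [T2Space Y]
    {E : (Metric.sphere (0 : EuclideanSpace ℝ (Fin (k + 1))) 1) × EuclideanSpace ℝ (Fin k) → Y}
    (hE : IsOpenEmbedding E) :
    ∃ rd : localHomologyOfSet ℤ ℤ Y (E '' (univ ×ˢ ({0} : Set (EuclideanSpace ℝ (Fin k))))) k →ₗ[ℤ] ℤ,
      Bijective rd ∧
      ∀ {N : ℕ} (hN : k + k = N) (w : singularHomology ℤ ℤ Y N)
        (x₀ : Metric.sphere (0 : EuclideanSpace ℝ (Fin (k + 1))) 1),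
        (∃ e : localHomology ℤ ℤ Y (E (x₀, 0)) N ≃ₗ[ℤ] ℤ,
            e (singularHomology.toLocal ℤ ℤ (E (x₀, 0)) N w) = 1) →
        ∃ ε : ℤ, (ε = 1 ∨ ε = -1) ∧ ∀ c : singularCohomology ℤ ℤ Y k,
          rd (singularHomology.toLocalOfSet ℤ ℤ Y (E '' (univ ×ˢ ({0} : Set (EuclideanSpace ℝ (Fin k))))) k
              (capProduct hN c w)) =
            ε * kroneckerPairing ℤ ℤ (Metric.sphere (0 : EuclideanSpace ℝ (Fin (k + 1))) 1) k
              (singularCohomology.map ℤ ℤ (⟨fun x => E (x, 0), hE.continuous.comp (by fun_prop)⟩ :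
                C((Metric.sphere (0 : EuclideanSpace ℝ (Fin (k + 1))) 1), Y)) k c)
              (μS hk).fundamentalClass := by
  -- the model tube `j : Sᵏ × ℝᵏ → P` and the core slice `Z = j (Sᵏ × 0) = ι₁(Sᵏ)`
  obtain ⟨j, hj, hj0, hj1, hjZ⟩ := exists_modelTube k
  have hZD_iff : ∀ p : (Metric.sphere (0 : EuclideanSpace ℝ (Fin (k + 1))) 1) × EuclideanSpace ℝ (Fin k), p ∈ (univ ×ˢ ({0} : Set (EuclideanSpace ℝ (Fin k)))) ↔ p.2 = 0 := fun p => by simp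
  have himg : j '' (univ ×ˢ ({0} : Set (EuclideanSpace ℝ (Fin k)))) = range (ι₁ k) := by
    ext q
    constructor
    · rintro ⟨p, hp, rfl⟩
      have hp2 : p.2 = 0 := (hZD_iff p).1 hp
      have : j p = j (p.1, 0) := by rw [← hp2]
      rw [this, hj0]
      exact mem_range_self _
    · rintro ⟨x, rfl⟩
      exact ⟨(x, 0), (hZD_iff _).2 rfl, hj0 x⟩
  -- Phase 1 data, with `range (ι₁ k)` replaced by `j '' (Sᵏ × 0)`
  have key₁ := exists_sliceReading hk
  have key₂ : ∀ (z₀ : (Metric.sphere (0 : EuclideanSpace ℝ (Fin (k + 1))) 1) × (Metric.sphere (0 : EuclideanSpace ℝ (Fin (k + 1))) 1)) (hz₀ : z₀ ∈ range (ι₁ k)),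
      Injective (restrictToPoint ℤ ℤ hz₀ (k + k)) := fun z₀ hz₀ =>
    restrictToPoint_range_ι₁_injective hk hz₀
  rw [← himg] at key₁ key₂
  obtain ⟨ℓ, hℓbij, hℓ⟩ := key₁
  -- the two excisions
  have mE : MapsTo E (univ ×ˢ ({0} : Set (EuclideanSpace ℝ (Fin k))))ᶜ (E '' (univ ×ˢ ({0} : Set (EuclideanSpace ℝ (Fin k)))))ᶜ := SphereTube.mapsTo_compl_core hE.injective
  have mJ : MapsTo j (univ ×ˢ ({0} : Set (EuclideanSpace ℝ (Fin k))))ᶜ (j '' (univ ×ˢ ({0} : Set (EuclideanSpace ℝ (Fin k)))))ᶜ := SphereTube.mapsTo_compl_core hj.injective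
  have iE : ∀ q, IsIso (relativeSingularHomology.map ℤ ℤ ⟨E, hE.continuous⟩ mE q) := fun q =>
    isIso_relMap_of_isOpenEmbedding ℤ ℤ hE
      (AlgebraicTopology.FundamentalGroup.VanKampen.isClosed_image_core hE.continuous) mE q
  have iJ : ∀ q, IsIso (relativeSingularHomology.map ℤ ℤ ⟨j, hj.continuous⟩ mJ q) := fun q =>
    isIso_relMap_of_isOpenEmbedding ℤ ℤ hj
      (AlgebraicTopology.FundamentalGroup.VanKampen.isClosed_image_core hj.continuous) mJ q
  -- the reading
  let rd : localHomologyOfSet ℤ ℤ Y (E '' (univ ×ˢ ({0} : Set (EuclideanSpace ℝ (Fin k))))) k →ₗ[ℤ] ℤ :=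
    ℓ ∘ₗ (relativeSingularHomology.map ℤ ℤ ⟨j, hj.continuous⟩ mJ k).hom ∘ₗ
      (inv (relativeSingularHomology.map ℤ ℤ ⟨E, hE.continuous⟩ mE k)).hom
  have hrd : ∀ z, rd z = ℓ (relativeSingularHomology.map ℤ ℤ ⟨j, hj.continuous⟩ mJ k
      (inv (relativeSingularHomology.map ℤ ℤ ⟨E, hE.continuous⟩ mE k) z)) := fun z => rfl
  refine ⟨rd, ?_, ?_⟩
  · have bJ := (ConcreteCategory.isIso_iff_bijective
      (relativeSingularHomology.map ℤ ℤ ⟨j, hj.continuous⟩ mJ k)).1 (iJ k)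
    haveI := iE k
    have bE := (ConcreteCategory.isIso_iff_bijective
      (inv (relativeSingularHomology.map ℤ ℤ ⟨E, hE.continuous⟩ mE k))).1 inferInstance
    exact hℓbij.comp (bJ.comp bE)
  intro N hN w x₀ hgen
  subst hN
  haveI := iE (k + k)
  haveI := iJ (k + k)
  haveI := iE k
  haveI := iJ k
  -- the model orientation
  letI := chartedSpace k
  haveI := SphereProd.simplyConnectedSpace (k := k) hk
  obtain ⟨μP⟩ := isOrientableOver hk
  have hfc := HomologicalOrientation.isFundamentalClass_fundamentalClass_holds (R := ℤ)
    (X := ((Metric.sphere (0 : EuclideanSpace ℝ (Fin (k + 1))) 1) × (Metric.sphere (0 : EuclideanSpace ℝ (Fin (k + 1))) 1))) (k + k) μP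
  -- base points
  have hz₀D_mem : ((x₀, 0) : (Metric.sphere (0 : EuclideanSpace ℝ (Fin (k + 1))) 1) × EuclideanSpace ℝ (Fin k)) ∈ (univ ×ˢ ({0} : Set (EuclideanSpace ℝ (Fin k)))) := (hZD_iff _).2 rfl
  have hz₀ : j (x₀, 0) ∈ j '' (univ ×ˢ ({0} : Set (EuclideanSpace ℝ (Fin k)))) := mem_image_of_mem j hz₀D_mem
  have hy₀ : E (x₀, 0) ∈ E '' (univ ×ˢ ({0} : Set (EuclideanSpace ℝ (Fin k)))) := mem_image_of_mem E hz₀D_mem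
  -- point-level excisions
  have mEpt : MapsTo E ({((x₀, 0) : (Metric.sphere (0 : EuclideanSpace ℝ (Fin (k + 1))) 1) × EuclideanSpace ℝ (Fin k))} : Set _)ᶜ ({E (x₀, 0)} : Set Y)ᶜ := fun p hp h =>
    hp (hE.injective (mem_singleton_iff.1 h))
  have mJpt : MapsTo j ({((x₀, 0) : (Metric.sphere (0 : EuclideanSpace ℝ (Fin (k + 1))) 1) × EuclideanSpace ℝ (Fin k))} : Set _)ᶜ ({j (x₀, 0)} : Set _)ᶜ := fun p hp h =>
    hp (hj.injective (mem_singleton_iff.1 h))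
  have iEpt : IsIso (relativeSingularHomology.map ℤ ℤ ⟨E, hE.continuous⟩ mEpt (k + k)) :=
    isIso_relMap_of_isOpenEmbedding_of_eq hE image_singleton isClosed_singleton mEpt (k + k)
  have iJpt : IsIso (relativeSingularHomology.map ℤ ℤ ⟨j, hj.continuous⟩ mJpt (k + k)) :=
    isIso_relMap_of_isOpenEmbedding_of_eq hj image_singleton isClosed_singleton mJpt (k + k)
  -- the two local orientation classes along the core, on the tube
  obtain ⟨DY, hDY⟩ := ((ConcreteCategory.isIso_iff_bijective
      (relativeSingularHomology.map ℤ ℤ ⟨E, hE.continuous⟩ mE (k + k))).1 (iE (k + k))).2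
      (singularHomology.toLocalOfSet ℤ ℤ Y (E '' (univ ×ˢ ({0} : Set (EuclideanSpace ℝ (Fin k))))) (k + k) w)
  obtain ⟨DP, hDP⟩ := ((ConcreteCategory.isIso_iff_bijective
      (relativeSingularHomology.map ℤ ℤ ⟨j, hj.continuous⟩ mJ (k + k))).1 (iJ (k + k))).2
      (singularHomology.toLocalOfSet ℤ ℤ ((Metric.sphere (0 : EuclideanSpace ℝ (Fin (k + 1))) 1) × (Metric.sphere (0 : EuclideanSpace ℝ (Fin (k + 1))) 1)) (j '' (univ ×ˢ ({0} : Set (EuclideanSpace ℝ (Fin k))))) (k + k) μP.fundamentalClass)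
  -- (T3) they agree up to sign: both restrict to generators at the base point
  have hgenP : ∃ e : localHomology ℤ ℤ ((Metric.sphere (0 : EuclideanSpace ℝ (Fin (k + 1))) 1) × (Metric.sphere (0 : EuclideanSpace ℝ (Fin (k + 1))) 1)) (j (x₀, 0)) (k + k) ≃ₗ[ℤ] ℤ,
      e (restrictToPoint ℤ ℤ hz₀ (k + k)
        (relativeSingularHomology.map ℤ ℤ ⟨j, hj.continuous⟩ mJ (k + k) DP)) = 1 := by
    rw [hDP, singularHomology.restrictToPoint_toLocalOfSet, hfc (j (x₀, 0))]
    exact μP.isGenerator _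
  have hgenY : ∃ e : localHomology ℤ ℤ ((Metric.sphere (0 : EuclideanSpace ℝ (Fin (k + 1))) 1) × (Metric.sphere (0 : EuclideanSpace ℝ (Fin (k + 1))) 1)) (j (x₀, 0)) (k + k) ≃ₗ[ℤ] ℤ,
      e (restrictToPoint ℤ ℤ hz₀ (k + k)
        (relativeSingularHomology.map ℤ ℤ ⟨j, hj.continuous⟩ mJ (k + k) DY)) = 1 := by
    rw [restrictToPoint_map_comm ⟨j, hj.continuous⟩ mJ hz₀D_mem hz₀ mJpt]
    -- the restriction of `DY` to the base point of the tube is a generator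
    have hd : relativeSingularHomology.map ℤ ℤ ⟨E, hE.continuous⟩ mEpt (k + k)
        (restrictToPoint ℤ ℤ hz₀D_mem (k + k) DY) =
        singularHomology.toLocal ℤ ℤ (E (x₀, 0)) (k + k) w := by
      rw [← restrictToPoint_map_comm ⟨E, hE.continuous⟩ mE hz₀D_mem hy₀ mEpt, hDY,
        singularHomology.restrictToPoint_toLocalOfSet]
      rfl
    have hdgen : ∃ e : localHomology ℤ ℤ ((Metric.sphere (0 : EuclideanSpace ℝ (Fin (k + 1))) 1) × EuclideanSpace ℝ (Fin k)) ((x₀, 0) : (Metric.sphere (0 : EuclideanSpace ℝ (Fin (k + 1))) 1) × EuclideanSpace ℝ (Fin k)) (k + k) ≃ₗ[ℤ] ℤ,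
        e (restrictToPoint ℤ ℤ hz₀D_mem (k + k) DY) = 1 := by
      haveI := iEpt
      obtain ⟨e, he⟩ := hgen
      refine ⟨(asIso (relativeSingularHomology.map ℤ ℤ ⟨E, hE.continuous⟩ mEpt (k + k))).toLinearEquiv ≪≫ₗ e, ?_⟩
      rw [LinearEquiv.trans_apply, Iso.toLinearEquiv_apply, asIso_hom]
      erw [hd]
      exact he
    haveI := iJpt
    obtain ⟨e, he⟩ :=
      AlgebraicTopology.SingularHomology.exists_linearEquiv_apply_eq_one_of_linearEquiv
        (asIso (relativeSingularHomology.map ℤ ℤ ⟨j, hj.continuous⟩ mJpt (k + k))).toLinearEquiv hdgen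
    refine ⟨e, ?_⟩
    rw [Iso.toLinearEquiv_apply, asIso_hom] at he
    exact he
  obtain ⟨ε, hε, hαβ⟩ := eq_or_eq_neg_of_generators hgenY hgenP
  have hDYP : DY = ε • DP := by
    apply ((ConcreteCategory.isIso_iff_bijective
      (relativeSingularHomology.map ℤ ℤ ⟨j, hj.continuous⟩ mJ (k + k))).1 (iJ (k + k))).1
    apply key₂ _ hz₀
    rw [hαβ, map_zsmul, map_zsmul]
  -- the sign of the model: `x = ⟨g₁ ⌣ g₂, [P]⟩ = ±1`
  have hx : cupPairing μP rfl (g hk 0) (g hk 1) = 1 ∨ cupPairing μP rfl (g hk 0) (g hk 1) = -1 :=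
    abs_eq (by norm_num) |>.1 (abs_cupPairing_g hk μP)
  refine ⟨ε * cupPairing μP rfl (g hk 0) (g hk 1), ?_, fun c => ?_⟩
  · rcases hε with rfl | rfl <;> rcases hx with h | h <;> rw [h] <;> norm_num
  -- (a) `E^* c = t • j^* g₁` on the tube, `t = ⟨c|_S, [S]⟩`
  set t : ℤ := kroneckerPairing ℤ ℤ (Metric.sphere (0 : EuclideanSpace ℝ (Fin (k + 1))) 1) k
    (singularCohomology.map ℤ ℤ (⟨fun x => E (x, 0), hE.continuous.comp (by fun_prop)⟩ : C((Metric.sphere (0 : EuclideanSpace ℝ (Fin (k + 1))) 1), Y)) k c)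
    (μS hk).fundamentalClass with ht
  have hEc : singularCohomology.map ℤ ℤ (⟨E, hE.continuous⟩ : C((Metric.sphere (0 : EuclideanSpace ℝ (Fin (k + 1))) 1) × EuclideanSpace ℝ (Fin k), Y)) k c =
      t • singularCohomology.map ℤ ℤ (⟨j, hj.continuous⟩ : C((Metric.sphere (0 : EuclideanSpace ℝ (Fin (k + 1))) 1) × EuclideanSpace ℝ (Fin k), ((Metric.sphere (0 : EuclideanSpace ℝ (Fin (k + 1))) 1) × (Metric.sphere (0 : EuclideanSpace ℝ (Fin (k + 1))) 1)))) k (g hk 0) := by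
    have h := SphereTube.eq_smul_map_fst_γ hk
      (singularCohomology.map ℤ ℤ (⟨E, hE.continuous⟩ : C((Metric.sphere (0 : EuclideanSpace ℝ (Fin (k + 1))) 1) × EuclideanSpace ℝ (Fin k), Y)) k c)
    have e1 : singularCohomology.map ℤ ℤ (⟨fun x => (x, 0), by fun_prop⟩ : C((Metric.sphere (0 : EuclideanSpace ℝ (Fin (k + 1))) 1), (Metric.sphere (0 : EuclideanSpace ℝ (Fin (k + 1))) 1) × EuclideanSpace ℝ (Fin k))) k
        (singularCohomology.map ℤ ℤ (⟨E, hE.continuous⟩ : C((Metric.sphere (0 : EuclideanSpace ℝ (Fin (k + 1))) 1) × EuclideanSpace ℝ (Fin k), Y)) k c) =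
        singularCohomology.map ℤ ℤ (⟨fun x => E (x, 0), hE.continuous.comp (by fun_prop)⟩ : C((Metric.sphere (0 : EuclideanSpace ℝ (Fin (k + 1))) 1), Y)) k c := by
      rw [← ModuleCat.comp_apply, ← singularCohomology.map_comp]
      rfl
    have e2 : singularCohomology.map ℤ ℤ (⟨Prod.fst, continuous_fst⟩ : C((Metric.sphere (0 : EuclideanSpace ℝ (Fin (k + 1))) 1) × EuclideanSpace ℝ (Fin k), (Metric.sphere (0 : EuclideanSpace ℝ (Fin (k + 1))) 1))) k (γ hk) =
        singularCohomology.map ℤ ℤ (⟨j, hj.continuous⟩ : C((Metric.sphere (0 : EuclideanSpace ℝ (Fin (k + 1))) 1) × EuclideanSpace ℝ (Fin k), ((Metric.sphere (0 : EuclideanSpace ℝ (Fin (k + 1))) 1) × (Metric.sphere (0 : EuclideanSpace ℝ (Fin (k + 1))) 1)))) k (g hk 0) := by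
      have hc : (pr₁ k).comp (⟨j, hj.continuous⟩ : C((Metric.sphere (0 : EuclideanSpace ℝ (Fin (k + 1))) 1) × EuclideanSpace ℝ (Fin k), ((Metric.sphere (0 : EuclideanSpace ℝ (Fin (k + 1))) 1) × (Metric.sphere (0 : EuclideanSpace ℝ (Fin (k + 1))) 1)))) =
          (⟨Prod.fst, continuous_fst⟩ : C((Metric.sphere (0 : EuclideanSpace ℝ (Fin (k + 1))) 1) × EuclideanSpace ℝ (Fin k), (Metric.sphere (0 : EuclideanSpace ℝ (Fin (k + 1))) 1))) := by
        exact ContinuousMap.ext fun p => hj1 p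
      rw [g, pr_zero, ← ModuleCat.comp_apply, ← singularCohomology.map_comp, hc]
    rw [e1, e2] at h
    exact h
  -- (b) on the tube, `(c ⌢ w)|_C` is `E^* c ⌢ DY`
  have hcapY : inv (relativeSingularHomology.map ℤ ℤ ⟨E, hE.continuous⟩ mE k)
      (singularHomology.toLocalOfSet ℤ ℤ Y (E '' (univ ×ˢ ({0} : Set (EuclideanSpace ℝ (Fin k))))) k (capProduct rfl c w)) =
      relCapProduct (univ ×ˢ ({0} : Set (EuclideanSpace ℝ (Fin k))))ᶜ rfl
        (singularCohomology.map ℤ ℤ (⟨E, hE.continuous⟩ : C((Metric.sphere (0 : EuclideanSpace ℝ (Fin (k + 1))) 1) × EuclideanSpace ℝ (Fin k), Y)) k c) DY := by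
    apply ((ConcreteCategory.isIso_iff_bijective
      (relativeSingularHomology.map ℤ ℤ ⟨E, hE.continuous⟩ mE k)).1 (iE k)).1
    rw [IsIso.inv_hom_id_apply, relativeSingularHomology.map_relCapProduct, hDY,
      singularHomology.toLocalOfSet, singularHomology.toLocalOfSet, relCapProduct_ofAbsolute]
  -- (c) push forward to the model: `j_* (E^* c ⌢ DY) = (t ε) • (g₁ ⌢ [P])|_Z`
  have hcapP : relativeSingularHomology.map ℤ ℤ ⟨j, hj.continuous⟩ mJ k
      (relCapProduct (univ ×ˢ ({0} : Set (EuclideanSpace ℝ (Fin k))))ᶜ rfl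
        (singularCohomology.map ℤ ℤ (⟨E, hE.continuous⟩ : C((Metric.sphere (0 : EuclideanSpace ℝ (Fin (k + 1))) 1) × EuclideanSpace ℝ (Fin k), Y)) k c) DY) =
      (t * ε) • singularHomology.toLocalOfSet ℤ ℤ ((Metric.sphere (0 : EuclideanSpace ℝ (Fin (k + 1))) 1) × (Metric.sphere (0 : EuclideanSpace ℝ (Fin (k + 1))) 1)) (j '' (univ ×ˢ ({0} : Set (EuclideanSpace ℝ (Fin k))))) k
        (capProduct rfl (g hk 0) μP.fundamentalClass) := by
    rw [hEc, hDYP]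
    have e4 : relCapProduct (univ ×ˢ ({0} : Set (EuclideanSpace ℝ (Fin k))))ᶜ (rfl : k + k = k + k)
        (t • singularCohomology.map ℤ ℤ (⟨j, hj.continuous⟩ : C((Metric.sphere (0 : EuclideanSpace ℝ (Fin (k + 1))) 1) × EuclideanSpace ℝ (Fin k), ((Metric.sphere (0 : EuclideanSpace ℝ (Fin (k + 1))) 1) × (Metric.sphere (0 : EuclideanSpace ℝ (Fin (k + 1))) 1)))) k (g hk 0)) DP =
        t • relCapProduct (univ ×ˢ ({0} : Set (EuclideanSpace ℝ (Fin k))))ᶜ (rfl : k + k = k + k)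
          (singularCohomology.map ℤ ℤ (⟨j, hj.continuous⟩ : C((Metric.sphere (0 : EuclideanSpace ℝ (Fin (k + 1))) 1) × EuclideanSpace ℝ (Fin k), ((Metric.sphere (0 : EuclideanSpace ℝ (Fin (k + 1))) 1) × (Metric.sphere (0 : EuclideanSpace ℝ (Fin (k + 1))) 1)))) k (g hk 0)) DP := by
      rw [map_zsmul]; rfl
    rw [map_zsmul, e4, smul_smul, mul_comm ε t, map_zsmul, relativeSingularHomology.map_relCapProduct,
      hDP, singularHomology.toLocalOfSet, singularHomology.toLocalOfSet, relCapProduct_ofAbsolute]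
  -- (d) read off
  rw [hrd, hcapY, hcapP, map_zsmul, hℓ, ← poincareDualityMap_apply,
    ← cupPairing_eq_kroneckerPairing_poincareDualityMap, zsmul_eq_mul, Int.cast_id]
  ring

end Tube

end SphereProd

end Literature.Topology.FourManifolds
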